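/-
Copyright (c) 2026 the pub-hodgecm-mathlib formalisation cell (harness21).  Prover seat hodgecm-mathlib-F0P3a-p01 (g18): road «S3-ram», (Cnt2′) ROUTE B, chair F0P3a-p07 (g15)
RULING (18) — «HYP ROOT CENSUS LAWS» (F0P3-p01 (g19) 05:43:38Z: «hyp root line counts in params currency = p849534's RHS»), 2026-09-02.
-/
import Literature.NumberTheory.Rogawski1990.DepthZeroKappaTransferTypeTwoRamifiedHyperbolicRootCensusParams   -- ★ p849618 (this seat): `hyperbolicRootCensus_params_odd_ram`
import Literature.NumberTheory.Rogawski1990.DepthZeroKappaTransferTypeTwoRamifiedBlockRootCensusIotaShape     -- ★ p849534 (F0P3a-p02 (g18)): the ι-shape adapter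
import HarnessLib

/-!
# «HYP ROOT CENSUS LAWS» — the hyperbolic literal's root region and collar sums at odd root depth, in closed form up to the Jacobsthal-type atom
# (Rogawski 1990 §4.9; Kottwitz 1986 §3; Labesse–Langlands 1979 §2)

Topic `NumberTheory/Rogawski1990`; namespace `Literature.NumberTheory.Rogawski1990.BlockLawHyp`.  THEOREMS ONLY; kernel lane `--supports stmt-HodgeConjecture-24833`; cell
`pub/hodgecm-mathlib` (D-0151), crux H413; road «S3-ram» (count-neutral).

`hyperbolicRootCensus_laws_odd_ram` = ★ p849618 `hyperbolicRootCensus_params_odd_ram` (this seat: leading matrix `Y`, residual symmetry ∕ irreducibility, sign clause, root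
region `{L₀}`, collar sums as `q`·conic fibres) ∘ ★ p849534 (F0P3a-p02 (g18): `natCard_params_iotaShape_null_eq`, `two_mul_natCard_params_iotaShape_quadraticChar_eq` on the
ι-shaped residual matrix `ι(Ȳ, 0)`): at the J0diff + (h1) binders of ★ p849287 ∕ ★ p849335 (F0P3a-p08 (g20)) and a unit class constant `c = c₀`,
`ΣE = q·(1 + χ(D̄))`, `2·ΣP = q·(q − χ(D̄) + χ(−2c̄₀′)·J)`, `2·ΣM = q·(q − χ(D̄) − χ(−2c̄₀′)·J)`, `D̄ = Ȳ₀₀² − Ȳ₀₁Ȳ₁₀`, `c̄₀′ = (−c̄₀)⁻¹`,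
`J = Σ_v χ(v + 2Ȳ₀₀)χ(v² − 4Ȳ₀₁Ȳ₁₀)`, and `(β,θ)_v = ±1 ⟺ χ(D̄) = ±1`.  So the zero cell (★ p849531) and the hyperbolic half of `stub_Zpair_pm_odd_A` (F0P3-p01 (g19)) are
`linear_combination`s over ★ p849287 ∕ ★ p849335 at `sR := {L₀}`.
HONEST LABEL: HC_CM is proved only modulo the 2 remaining named inputs (hLiu418 24832, h413 24833) until rung 0 closes; composition of ★ theorems; «S3-ram» has no books consequence.

References: [cite: Rogawski1990, §4.9 Prop. 4.9.1 (b) p. 55, Lemma 4.9.3 p. 56]; [cite: Kottwitz1986, §3]; [cite: LabesseLanglands1979, §2 Lemma 2.1]; [cite: IrelandRosen1990, Ch. 8 §1].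
-/

set_option autoImplicit false

noncomputable section

open NumberField IsDedekindDomain Matrix Polynomial ValuativeRel
open Literature.NumberTheory.Automorphic Literature.NumberTheory.Automorphic.UnitaryGroup
open Literature.NumberTheory.Automorphic.UnitaryLatticeTree Literature.NumberTheory.Automorphic.HermitianLattice
open Literature.NumberTheory.GaloisRepresentations Literature.NumberTheory.QuadraticForms
open Literature.NumberTheory.Rogawski1990 Literature.NumberTheory.Rogawski1990.TypeOneRamifiedJunction
open scoped Matrix MatrixGroups ValuativeRel WithZero

namespace Literature.NumberTheory.Rogawski1990.BlockLawHyp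

variable (L : Type) [Field L] [NumberField L] [IsCMField L] {v : HeightOneSpectrum (𝓞 ↥(maximalRealSubfield L))}

set_option maxHeartbeats 3200000 in
-- budget only: statement-heavy socket tokens; the proof is a composition of ★ heads.
/-- **«HYP ROOT CENSUS LAWS»** — `hyperbolicRootCensus_params_odd_ram` ∘ F0P3a-p02 (g18)'s ι-shape adapter ★ p849534 (`natCard_params_iotaShape_null_eq`,
`two_mul_natCard_params_iotaShape_quadraticChar_eq`): at the same binders, the root region `{L₀}` and the three collar sums of ★ p849287∕p849335 at `sR := {L₀}` in CLOSED form —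
`ΣE = q·(1 + χ(D̄))`, `2·ΣP = q·(q − χ(D̄) + χ(−2c̄₀′)·J)`, `2·ΣM = q·(q − χ(D̄) − χ(−2c̄₀′)·J)` with `D̄ = Ȳ₀₀² − Ȳ₀₁Ȳ₁₀ = det Ȳ`, `c̄₀′ = (−c̄₀)⁻¹`,
`J = Σ_v χ(v + 2Ȳ₀₀)·χ(v² − 4Ȳ₀₁Ȳ₁₀)` (the Jacobsthal-type atom, UNEVALUATED — it cancels against the anisotropic root in the joint cell) — together with the sign dichotomy
`(β,θ)_v = 1 ⟺ χ(D̄) = 1`, `(β,θ)_v = −1 ⟺ χ(D̄) = −1` (★ chair `typeTwo_depthDictionary_odd_ram` ∕ p849319; `D̄ ≠ 0` from irreducibility).  The hyperbolic half of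
`stub_Zpair_pm_odd_A` (F0P3-p01 (g19)) and the zero cell are `linear_combination`s over ★ p849335 ∕ ★ p849287 and this. [cite: Rogawski1990, §4.9 Prop. 4.9.1 (b) p. 55, Lemma 4.9.3 p. 56]
[cite: Kottwitz1986, §3] [cite: LabesseLanglands1979, §2 Lemma 2.1] [cite: IrelandRosen1990, Ch. 8 §1] -/
theorem hyperbolicRootCensus_laws_odd_ram (w : PlacesOver L v)
    (hw : IsCMField.complexConj L • w.1 = w.1) (he : v.asIdeal.ramificationIdx' w.1.asIdeal ≠ 1)
    (h2 : IsUnit (2 : 𝒪[(w.1.adicCompletion L)]))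
    (ϖ : w.1.adicCompletion L) (hϖ : Valued.v ϖ = WithZero.exp (-1 : ℤ)) (hσϖ : galAdicCompletionMap (L := L) (IsCMField.complexConj L) hw ϖ = -ϖ)
    (γH : ((cmDatum L 2 (Matrix.of fun i j : Fin 2 => if i.val + j.val + 1 = 2 then (1 : L) else 0)).Local v ×
      (cmDatum L 1 (Matrix.of fun i j : Fin 1 => if i.val + j.val + 1 = 1 then (1 : L) else 0)).Local v))
    (hblk : ∀ i j : Fin 2, Valued.v (((((γH.1.val : GL (Fin 2) (UnitaryGroup.LocalRing L v)).val.map (Pi.evalRingHom (fun w' : PlacesOver L v => w'.1.adicCompletion L) w))) - 1) i j) ≤ Valued.v (ϖ ^ 2))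
    (hu2 : Valued.v (finGammaTwo L v γH w - 1) ≤ Valued.v (ϖ ^ 2))
    (hirr : ¬ ∃ x : (w.1.adicCompletion L), ((((γH.1.val : GL (Fin 2) (UnitaryGroup.LocalRing L v)).val.map
      (Pi.evalRingHom (fun w' : PlacesOver L v => w'.1.adicCompletion L) w))).charpoly).IsRoot x)
    {n : ℕ} (hdisc : Valued.v ((((γH.1.val : GL (Fin 2) (UnitaryGroup.LocalRing L v)).val.map (Pi.evalRingHom (fun w' : PlacesOver L v => w'.1.adicCompletion L) w))).trace ^ 2 - 4 * (((γH.1.val : GL (Fin 2) (UnitaryGroup.LocalRing L v)).val.map (Pi.evalRingHom (fun w' : PlacesOver L v => w'.1.adicCompletion L) w))).det) = WithZero.exp (-((2 * (2 * n + 1) : ℕ) : ℤ)))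
    (hn : 1 ≤ n) (m : ℕ) (hm : Valued.v (((finCharpolyTwo L v γH).eval (finGammaTwo L v γH)) w) =
          Valued.v ((toPlace v w (HeckeCharacter.uniformizer ↥(maximalRealSubfield L) v : v.adicCompletion ↥(maximalRealSubfield L))) ^ m))
    (β : (v.adicCompletion ↥(maximalRealSubfield L))ˣ)
    (hβ : toPlace v w (β : v.adicCompletion ↥(maximalRealSubfield L)) =
          -(((finCharpolyTwo L v γH).eval (finGammaTwo L v γH)) w *
              (finGammaTwo L v γH w ^ 2 +
                ((γH.1.val.val : Matrix (Fin 2) (Fin 2) (LocalRing L v)).map (Pi.evalRingHom (fun w' : PlacesOver L v => w'.1.adicCompletion L) w)).det)) /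
            (2 * finGammaTwo L v γH w ^ 2 *
              ((γH.1.val.val : Matrix (Fin 2) (Fin 2) (LocalRing L v)).map (Pi.evalRingHom (fun w' : PlacesOver L v => w'.1.adicCompletion L) w)).det))
    (hmN : m = 2 * n + 1)
    (s : (w.1.adicCompletion L)ˣ) (hs : (s : w.1.adicCompletion L) * (((localNonsplitEquiv (IsCMField.complexConj L) (Matrix.of fun i j : Fin 1 => if i.val + j.val + 1 = 1 then (1 : L) else 0) (IsCMField.complexConj_ne_one L) w hw γH.2).val : GL (Fin 1) (w.1.adicCompletion L)) : Matrix (Fin 1) (Fin 1) (w.1.adicCompletion L)) 0 0 = 1)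
    (k : GL (Fin 2) (w.1.adicCompletion L))
    (hk : k ∈ unitaryGroupOfForm (galAdicCompletionMap (L := L) (IsCMField.complexConj L) hw)
      (placeForm (Matrix.of fun i j : Fin 2 => if i.val + j.val + 1 = 2 then (1 : L) else 0) w.1))
    (hd : ∀ i j, Valued.v (((((k⁻¹ * (Matrix.GeneralLinearGroup.scalar (Fin 2) s * ((localNonsplitEquiv (IsCMField.complexConj L) (Matrix.of fun i j : Fin 2 => if i.val + j.val + 1 = 2 then (1 : L) else 0) (IsCMField.complexConj_ne_one L) w hw γH.1).val : GL (Fin 2) (w.1.adicCompletion L))) * k) : GL (Fin 2) (w.1.adicCompletion L)) : Matrix (Fin 2) (Fin 2) (w.1.adicCompletion L)) - 1) i j) ≤ Valued.v ϖ ^ m)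
    (γ' : unitaryGroupOfForm (galAdicCompletionMap (L := L) (IsCMField.complexConj L) hw) ((StdForm.antidiagonal 3).over (w.1.adicCompletion L)))
    (hγ' : (γ' : GL (Fin 3) (w.1.adicCompletion L)) = endoGL ((k⁻¹ * (Matrix.GeneralLinearGroup.scalar (Fin 2) s * ((localNonsplitEquiv (IsCMField.complexConj L) (Matrix.of fun i j : Fin 2 => if i.val + j.val + 1 = 2 then (1 : L) else 0) (IsCMField.complexConj_ne_one L) w hw γH.1).val : GL (Fin 2) (w.1.adicCompletion L))) * k), (1 : GL (Fin 1) (w.1.adicCompletion L))))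
    [Fintype (Valued.ResidueField (w.1.adicCompletion L))] [DecidableEq (Valued.ResidueField (w.1.adicCompletion L))] 
    (c : w.1.adicCompletion L) (c₀ : Valued.integer (w.1.adicCompletion L)) (hc₀ : (c₀ : w.1.adicCompletion L) = c) (hc : Valued.v c = 1) :
    ∃ Y : Matrix (Fin 2) (Fin 2) (Valued.integer (w.1.adicCompletion L)),
    (∀ i j, ((Y i j : Valued.integer (w.1.adicCompletion L)) : (w.1.adicCompletion L)) = (ϖ ^ m)⁻¹ * (((k⁻¹ * (Matrix.GeneralLinearGroup.scalar (Fin 2) s * ((localNonsplitEquiv (IsCMField.complexConj L) (Matrix.of fun i j : Fin 2 => if i.val + j.val + 1 = 2 then (1 : L) else 0) (IsCMField.complexConj_ne_one L) w hw γH.1).val : GL (Fin 2) (w.1.adicCompletion L))) * k : GL (Fin 2) (w.1.adicCompletion L)) : Matrix (Fin 2) (Fin 2) (w.1.adicCompletion L)) - 1) i j) ∧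
    (hilbertSymbol (v.adicCompletion ↥(maximalRealSubfield L)) (β : v.adicCompletion ↥(maximalRealSubfield L)) (algebraMap ↥(maximalRealSubfield L) _ ((cmQuadraticGenerator L : 𝓞 ↥(maximalRealSubfield L)) : ↥(maximalRealSubfield L))) = 1 ↔
      quadraticChar (Valued.ResidueField (w.1.adicCompletion L)) (IsLocalRing.residue (Valued.integer (w.1.adicCompletion L)) (Y 0 0) ^ 2 - IsLocalRing.residue (Valued.integer (w.1.adicCompletion L)) (Y 0 1) * IsLocalRing.residue (Valued.integer (w.1.adicCompletion L)) (Y 1 0)) = 1) ∧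
    (hilbertSymbol (v.adicCompletion ↥(maximalRealSubfield L)) (β : v.adicCompletion ↥(maximalRealSubfield L)) (algebraMap ↥(maximalRealSubfield L) _ ((cmQuadraticGenerator L : 𝓞 ↥(maximalRealSubfield L)) : ↥(maximalRealSubfield L))) = -1 ↔
      quadraticChar (Valued.ResidueField (w.1.adicCompletion L)) (IsLocalRing.residue (Valued.integer (w.1.adicCompletion L)) (Y 0 0) ^ 2 - IsLocalRing.residue (Valued.integer (w.1.adicCompletion L)) (Y 0 1) * IsLocalRing.residue (Valued.integer (w.1.adicCompletion L)) (Y 1 0)) = -1) ∧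
    (∀ vtx, vtx ∈ ({⟨stdLattice (w.1.adicCompletion L) 3, 0, isSelfDualLattice_stdLattice_three_of_v hϖ⟩} : Finset {M : Submodule (Valued.integer (w.1.adicCompletion L)) (Fin 3 → (w.1.adicCompletion L)) // IsVertex (galAdicCompletionMap (L := L) (IsCMField.complexConj L) hw) ϖ ((StdForm.antidiagonal 3).over (w.1.adicCompletion L)) M}) ↔ vtx ∈ {vtx : {M : Submodule (Valued.integer (w.1.adicCompletion L)) (Fin 3 → (w.1.adicCompletion L)) // IsVertex (galAdicCompletionMap (L := L) (IsCMField.complexConj L) hw) ϖ ((StdForm.antidiagonal 3).over (w.1.adicCompletion L)) M} | latticeGraphIso (galAdicCompletionMap (L := L) (IsCMField.complexConj L) hw) ϖ ((StdForm.antidiagonal 3).over (w.1.adicCompletion L)) γ' vtx = vtx ∧ IsSelfDualLattice (galAdicCompletionMap (L := L) (IsCMField.complexConj L) hw) ϖ ((StdForm.antidiagonal 3).over (w.1.adicCompletion L)) vtx.1 ∧ vtx.1.map ((Matrix.toLin' (((γ' : GL (Fin 3) (w.1.adicCompletion L)) : Matrix (Fin 3) (Fin 3) (w.1.adicCompletion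 L)) - 1)).restrictScalars (Valued.integer (w.1.adicCompletion L))) ≤ scaleLattice (ϖ ^ m) vtx.1}) ∧
    ((∑ vtx ∈ ({⟨stdLattice (w.1.adicCompletion L) 3, 0, isSelfDualLattice_stdLattice_three_of_v hϖ⟩} : Finset {M : Submodule (Valued.integer (w.1.adicCompletion L)) (Fin 3 → (w.1.adicCompletion L)) // IsVertex (galAdicCompletionMap (L := L) (IsCMField.complexConj L) hw) ϖ ((StdForm.antidiagonal 3).over (w.1.adicCompletion L)) M}), ({wtx | wtx ∈ {wtx | ∃ cx, ((latticeGraph (galAdicCompletionMap (L := L) (IsCMField.complexConj L) hw) ϖ ((StdForm.antidiagonal 3).over (w.1.adicCompletion L))).Adj vtx cx ∧ (latticeGraph (galAdicCompletionMap (L := L) (IsCMField.complexConj L) hw) ϖ ((StdForm.antidiagonal 3).over (w.1.adicCompletion L))).dist ⟨stdLattice (w.1.adicCompletion L) 3, 0, isSelfDualLattice_stdLattice_three_of_v hϖ⟩ cx = (latticeGraph (galAdicCompletionMap (L := L) (IsCMField.complexConj L) hw) ϖ ((StdForm.antidiagonal 3).over (w.1.adicCompletion L))).dist ⟨stdLattice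 (w.1.adicCompletion L) 3, 0, isSelfDualLattice_stdLattice_three_of_v hϖ⟩ vtx + 1 ∧ latticeGraphIso (galAdicCompletionMap (L := L) (IsCMField.complexConj L) hw) ϖ ((StdForm.antidiagonal 3).over (w.1.adicCompletion L)) γ' cx = cx) ∧ ((latticeGraph (galAdicCompletionMap (L := L) (IsCMField.complexConj L) hw) ϖ ((StdForm.antidiagonal 3).over (w.1.adicCompletion L))).Adj cx wtx ∧ (latticeGraph (galAdicCompletionMap (L := L) (IsCMField.complexConj L) hw) ϖ ((StdForm.antidiagonal 3).over (w.1.adicCompletion L))).dist ⟨stdLattice (w.1.adicCompletion L) 3, 0, isSelfDualLattice_stdLattice_three_of_v hϖ⟩ wtx = (latticeGraph (galAdicCompletionMap (L := L) (IsCMField.complexConj L) hw) ϖ ((StdForm.antidiagonal 3).over (w.1.adicCompletion L))).dist ⟨stdLattice (w.1.adicCompletion L) 3, 0, isSelfDualLattice_stdLattice_three_of_v hϖ⟩ cx + 1 ∧ latticeGraphIso (galAdicCompletionMap (L := L) (IsCMField.complexConj L) hw) ϖ ((StdForm.antidiagonal 3).over (w.1.adicCompletion L)) γ' wtx = wtx)}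 ∧ (¬ wtx.1.map ((Matrix.toLin' (((γ' : GL (Fin 3) (w.1.adicCompletion L)) : Matrix (Fin 3) (Fin 3) (w.1.adicCompletion L)) - 1)).restrictScalars (Valued.integer (w.1.adicCompletion L))) ≤ scaleLattice (ϖ ^ m) wtx.1 ∧ (wtx.1.map ((Matrix.toLin' (((γ' : GL (Fin 3) (w.1.adicCompletion L)) : Matrix (Fin 3) (Fin 3) (w.1.adicCompletion L)) - 1)).restrictScalars (Valued.integer (w.1.adicCompletion L))) ≤ scaleLattice (ϖ ^ (m - 1)) wtx.1 ∧ ¬ wtx.1.map ((Matrix.toLin' (((γ' : GL (Fin 3) (w.1.adicCompletion L)) : Matrix (Fin 3) (Fin 3) (w.1.adicCompletion L)) - 1)).restrictScalars (Valued.integer (w.1.adicCompletion L))) ≤ scaleLattice (ϖ ^ m) wtx.1))}).ncard : ℕ) : ℤ) =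
      (Nat.card (Valued.ResidueField (w.1.adicCompletion L)) : ℤ) * (1 + quadraticChar (Valued.ResidueField (w.1.adicCompletion L)) (IsLocalRing.residue (Valued.integer (w.1.adicCompletion L)) (Y 0 0) ^ 2 - IsLocalRing.residue (Valued.integer (w.1.adicCompletion L)) (Y 0 1) * IsLocalRing.residue (Valued.integer (w.1.adicCompletion L)) (Y 1 0))) ∧
    2 * ((∑ vtx ∈ ({⟨stdLattice (w.1.adicCompletion L) 3, 0, isSelfDualLattice_stdLattice_three_of_v hϖ⟩} : Finset {M : Submodule (Valued.integer (w.1.adicCompletion L)) (Fin 3 → (w.1.adicCompletion L)) // IsVertex (galAdicCompletionMap (L := L) (IsCMField.complexConj L) hw) ϖ ((StdForm.antidiagonal 3).over (w.1.adicCompletion L)) M}), ({wtx | wtx ∈ {wtx | ∃ cx, ((latticeGraph (galAdicCompletionMap (L := L) (IsCMField.complexConj L) hw) ϖ ((StdForm.antidiagonal 3).over (w.1.adicCompletion L))).Adj vtx cx ∧ (latticeGraph (galAdicCompletionMap (L := L) (IsCMField.complexConj L) hw) ϖ ((StdForm.antidiagonal 3).over (w.1.adicCompletion L))).dist ⟨stdLattice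 (w.1.adicCompletion L) 3, 0, isSelfDualLattice_stdLattice_three_of_v hϖ⟩ cx = (latticeGraph (galAdicCompletionMap (L := L) (IsCMField.complexConj L) hw) ϖ ((StdForm.antidiagonal 3).over (w.1.adicCompletion L))).dist ⟨stdLattice (w.1.adicCompletion L) 3, 0, isSelfDualLattice_stdLattice_three_of_v hϖ⟩ vtx + 1 ∧ latticeGraphIso (galAdicCompletionMap (L := L) (IsCMField.complexConj L) hw) ϖ ((StdForm.antidiagonal 3).over (w.1.adicCompletion L)) γ' cx = cx) ∧ ((latticeGraph (galAdicCompletionMap (L := L) (IsCMField.complexConj L) hw) ϖ ((StdForm.antidiagonal 3).over (w.1.adicCompletion L))).Adj cx wtx ∧ (latticeGraph (galAdicCompletionMap (L := L) (IsCMField.complexConj L) hw) ϖ ((StdForm.antidiagonal 3).over (w.1.adicCompletion L))).dist ⟨stdLattice (w.1.adicCompletion L) 3, 0, isSelfDualLattice_stdLattice_three_of_v hϖ⟩ wtx = (latticeGraph (galAdicCompletionMap (L := L) (IsCMField.complexConj L) hw) ϖ ((StdForm.antidiagonal 3).over (w.1.adicCompletion L))).dist ⟨stdLattice (w.1.adicCompletion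 L) 3, 0, isSelfDualLattice_stdLattice_three_of_v hϖ⟩ cx + 1 ∧ latticeGraphIso (galAdicCompletionMap (L := L) (IsCMField.complexConj L) hw) ϖ ((StdForm.antidiagonal 3).over (w.1.adicCompletion L)) γ' wtx = wtx)} ∧ (¬ wtx.1.map ((Matrix.toLin' (((γ' : GL (Fin 3) (w.1.adicCompletion L)) : Matrix (Fin 3) (Fin 3) (w.1.adicCompletion L)) - 1)).restrictScalars (Valued.integer (w.1.adicCompletion L))) ≤ scaleLattice (ϖ ^ m) wtx.1 ∧ (wtx.1.map ((Matrix.toLin' (((γ' : GL (Fin 3) (w.1.adicCompletion L)) : Matrix (Fin 3) (Fin 3) (w.1.adicCompletion L)) - 1)).restrictScalars (Valued.integer (w.1.adicCompletion L))) ≤ scaleLattice (ϖ ^ (m - 2)) wtx.1 ∧ ¬ wtx.1.map ((Matrix.toLin' (((γ' : GL (Fin 3) (w.1.adicCompletion L)) : Matrix (Fin 3) (Fin 3) (w.1.adicCompletion L)) - 1)).restrictScalars (Valued.integer (w.1.adicCompletion L))) ≤ scaleLattice (ϖ ^ (m - 1)) wtx.1) ∧ ∃ y ∈ wtx.1, ∃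 a : (w.1.adicCompletion L), Valued.v a = 1 ∧ Valued.v ((ϖ ^ (m - 2))⁻¹ * pairing (galAdicCompletionMap (L := L) (IsCMField.complexConj L) hw) ((StdForm.antidiagonal 3).over (w.1.adicCompletion L)) y ((((γ' : GL (Fin 3) (w.1.adicCompletion L)) : Matrix (Fin 3) (Fin 3) (w.1.adicCompletion L)) - 1) *ᵥ y) - (c) * a ^ 2) < 1)}).ncard : ℕ) : ℤ) =
      (Nat.card (Valued.ResidueField (w.1.adicCompletion L)) : ℤ) * ((Nat.card (Valued.ResidueField (w.1.adicCompletion L)) : ℤ) - quadraticChar (Valued.ResidueField (w.1.adicCompletion L)) (IsLocalRing.residue (Valued.integer (w.1.adicCompletion L)) (Y 0 0) ^ 2 - IsLocalRing.residue (Valued.integer (w.1.adicCompletion L)) (Y 0 1) * IsLocalRing.residue (Valued.integer (w.1.adicCompletion L)) (Y 1 0)) +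
        quadraticChar (Valued.ResidueField (w.1.adicCompletion L)) (-2 * (IsLocalRing.residue (Valued.integer (w.1.adicCompletion L)) (-c₀))⁻¹) * (∑ v : Valued.ResidueField (w.1.adicCompletion L), quadraticChar (Valued.ResidueField (w.1.adicCompletion L)) (v + 2 * IsLocalRing.residue (Valued.integer (w.1.adicCompletion L)) (Y 0 0)) * quadraticChar (Valued.ResidueField (w.1.adicCompletion L)) (v ^ 2 - 4 * (IsLocalRing.residue (Valued.integer (w.1.adicCompletion L)) (Y 0 1) * IsLocalRing.residue (Valued.integer (w.1.adicCompletion L)) (Y 1 0))))) ∧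
    2 * ((∑ vtx ∈ ({⟨stdLattice (w.1.adicCompletion L) 3, 0, isSelfDualLattice_stdLattice_three_of_v hϖ⟩} : Finset {M : Submodule (Valued.integer (w.1.adicCompletion L)) (Fin 3 → (w.1.adicCompletion L)) // IsVertex (galAdicCompletionMap (L := L) (IsCMField.complexConj L) hw) ϖ ((StdForm.antidiagonal 3).over (w.1.adicCompletion L)) M}), ({wtx | wtx ∈ {wtx | ∃ cx, ((latticeGraph (galAdicCompletionMap (L := L) (IsCMField.complexConj L) hw) ϖ ((StdForm.antidiagonal 3).over (w.1.adicCompletion L))).Adj vtx cx ∧ (latticeGraph (galAdicCompletionMap (L := L) (IsCMField.complexConj L) hw) ϖ ((StdForm.antidiagonal 3).over (w.1.adicCompletion L))).dist ⟨stdLattice (w.1.adicCompletion L) 3, 0, isSelfDualLattice_stdLattice_three_of_v hϖ⟩ cx = (latticeGraph (galAdicCompletionMap (L := L) (IsCMField.complexConj L) hw) ϖ ((StdForm.antidiagonal 3).over (w.1.adicCompletion L))).dist ⟨stdLattice (w.1.adicCompletion L) 3, 0, isSelfDualLattice_stdLattice_three_of_v hϖ⟩ vtx + 1 ∧ latticeGraphIso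 (galAdicCompletionMap (L := L) (IsCMField.complexConj L) hw) ϖ ((StdForm.antidiagonal 3).over (w.1.adicCompletion L)) γ' cx = cx) ∧ ((latticeGraph (galAdicCompletionMap (L := L) (IsCMField.complexConj L) hw) ϖ ((StdForm.antidiagonal 3).over (w.1.adicCompletion L))).Adj cx wtx ∧ (latticeGraph (galAdicCompletionMap (L := L) (IsCMField.complexConj L) hw) ϖ ((StdForm.antidiagonal 3).over (w.1.adicCompletion L))).dist ⟨stdLattice (w.1.adicCompletion L) 3, 0, isSelfDualLattice_stdLattice_three_of_v hϖ⟩ wtx = (latticeGraph (galAdicCompletionMap (L := L) (IsCMField.complexConj L) hw) ϖ ((StdForm.antidiagonal 3).over (w.1.adicCompletion L))).dist ⟨stdLattice (w.1.adicCompletion L) 3, 0, isSelfDualLattice_stdLattice_three_of_v hϖ⟩ cx + 1 ∧ latticeGraphIso (galAdicCompletionMap (L := L) (IsCMField.complexConj L) hw) ϖ ((StdForm.antidiagonal 3).over (w.1.adicCompletion L)) γ' wtx = wtx)} ∧ (¬ wtx.1.map ((Matrix.toLin' (((γ' : GL (Fin 3) (w.1.adicCompletion L)) : Matrix (Fin 3)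 (Fin 3) (w.1.adicCompletion L)) - 1)).restrictScalars (Valued.integer (w.1.adicCompletion L))) ≤ scaleLattice (ϖ ^ m) wtx.1 ∧ (wtx.1.map ((Matrix.toLin' (((γ' : GL (Fin 3) (w.1.adicCompletion L)) : Matrix (Fin 3) (Fin 3) (w.1.adicCompletion L)) - 1)).restrictScalars (Valued.integer (w.1.adicCompletion L))) ≤ scaleLattice (ϖ ^ (m - 2)) wtx.1 ∧ ¬ wtx.1.map ((Matrix.toLin' (((γ' : GL (Fin 3) (w.1.adicCompletion L)) : Matrix (Fin 3) (Fin 3) (w.1.adicCompletion L)) - 1)).restrictScalars (Valued.integer (w.1.adicCompletion L))) ≤ scaleLattice (ϖ ^ (m - 1)) wtx.1) ∧ ¬ (∃ y ∈ wtx.1, ∃ a : (w.1.adicCompletion L), Valued.v a = 1 ∧ Valued.v ((ϖ ^ (m - 2))⁻¹ * pairing (galAdicCompletionMap (L := L) (IsCMField.complexConj L) hw) ((StdForm.antidiagonal 3).over (w.1.adicCompletion L)) y ((((γ' : GL (Fin 3) (w.1.adicCompletion L)) : Matrix (Fin 3) (Fin 3) (w.1.adicCompletion L)) - 1) *ᵥ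 y) - (c) * a ^ 2) < 1))}).ncard : ℕ) : ℤ) =
      (Nat.card (Valued.ResidueField (w.1.adicCompletion L)) : ℤ) * ((Nat.card (Valued.ResidueField (w.1.adicCompletion L)) : ℤ) - quadraticChar (Valued.ResidueField (w.1.adicCompletion L)) (IsLocalRing.residue (Valued.integer (w.1.adicCompletion L)) (Y 0 0) ^ 2 - IsLocalRing.residue (Valued.integer (w.1.adicCompletion L)) (Y 0 1) * IsLocalRing.residue (Valued.integer (w.1.adicCompletion L)) (Y 1 0)) -
        quadraticChar (Valued.ResidueField (w.1.adicCompletion L)) (-2 * (IsLocalRing.residue (Valued.integer (w.1.adicCompletion L)) (-c₀))⁻¹) * (∑ v : Valued.ResidueField (w.1.adicCompletion L), quadraticChar (Valued.ResidueField (w.1.adicCompletion L)) (v + 2 * IsLocalRing.residue (Valued.integer (w.1.adicCompletion L)) (Y 0 0)) * quadraticChar (Valued.ResidueField (w.1.adicCompletion L)) (v ^ 2 - 4 * (IsLocalRing.residue (Valued.integer (w.1.adicCompletion L)) (Y 0 1) * IsLocalRing.residue (Valued.integer (w.1.adicCompletion L)) (Y 1 0))))) := by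
  obtain ⟨Y, hY, hdiagr, hirrr, hHS, hsR, hE, hP, hM⟩ := hyperbolicRootCensus_params_odd_ram L w hw he h2 ϖ hϖ hσϖ γH hblk hu2 hirr hdisc hn m hm β hβ hmN
    s hs k hk hd γ' hγ' c c₀ hc₀ hc
  have h2v : Valued.v (2 : (w.1.adicCompletion L)) = 1 := (isUnit_two_integer_iff_valued_eq_one L w.1).1 h2
  have hk2 : ringChar (Valued.ResidueField (w.1.adicCompletion L)) ≠ 2 := ringChar_residueField_ne_two h2v
  have hc0 : (IsLocalRing.residue (Valued.integer (w.1.adicCompletion L)) (-c₀))⁻¹ ≠ 0 := by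
    refine inv_ne_zero fun h => ?_
    rw [residue_eq_zero_iff_v_lt_one] at h
    push_cast at h
    rw [Valuation.map_neg, hc₀, hc] at h
    exact lt_irrefl _ h
  -- the ι-shape binders of p02's adapter on `Ȳ' = ι(Ȳ, 0)`
  have hdiag' : (!![IsLocalRing.residue (Valued.integer (w.1.adicCompletion L)) (Y 0 0), 0, IsLocalRing.residue (Valued.integer (w.1.adicCompletion L)) (Y 0 1); 0, 0, 0; IsLocalRing.residue (Valued.integer (w.1.adicCompletion L)) (Y 1 0), 0, IsLocalRing.residue (Valued.integer (w.1.adicCompletion L)) (Y 1 1)] : Matrix (Fin 3) (Fin 3) (Valued.ResidueField (w.1.adicCompletion L))) 2 2 = (!![IsLocalRing.residue (Valued.integer (w.1.adicCompletion L)) (Y 0 0), 0, IsLocalRing.residue (Valued.integer (w.1.adicCompletion L)) (Y 0 1); 0, 0, 0; IsLocalRing.residue (Valued.integer (w.1.adicCompletion L)) (Y 1 0), 0, IsLocalRing.residue (Valued.integer (w.1.adicCompletion L)) (Y 1 1)] : Matrix (Fin 3) (Fin 3) (Valued.ResidueField (w.1.adicCompletion L))) 0 0 := by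
    simp only [Matrix.of_apply, Matrix.cons_val', Matrix.cons_val_zero, Matrix.cons_val_two, Matrix.tail_cons, Matrix.head_cons, Matrix.empty_val',
      Matrix.cons_val_fin_one]
    exact hdiagr.symm
  have hirr' : quadraticChar (Valued.ResidueField (w.1.adicCompletion L)) ((!![IsLocalRing.residue (Valued.integer (w.1.adicCompletion L)) (Y 0 0), 0, IsLocalRing.residue (Valued.integer (w.1.adicCompletion L)) (Y 0 1); 0, 0, 0; IsLocalRing.residue (Valued.integer (w.1.adicCompletion L)) (Y 1 0), 0, IsLocalRing.residue (Valued.integer (w.1.adicCompletion L)) (Y 1 1)] : Matrix (Fin 3) (Fin 3) (Valued.ResidueField (w.1.adicCompletion L))) 0 2 * (!![IsLocalRing.residue (Valued.integer (w.1.adicCompletion L)) (Y 0 0), 0, IsLocalRing.residue (Valued.integer (w.1.adicCompletion L)) (Y 0 1); 0, 0, 0; IsLocalRing.residue (Valued.integer (w.1.adicCompletion L)) (Y 1 0), 0, IsLocalRing.residue (Valued.integer (w.1.adicCompletion L)) (Y 1 1)] : Matrix (Fin 3) (Fin 3) (Valued.ResidueField (w.1.adicCompletion L))) 2 0) = -1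 := by
    simp only [Matrix.of_apply, Matrix.cons_val', Matrix.cons_val_zero, Matrix.cons_val_two, Matrix.tail_cons, Matrix.head_cons, Matrix.empty_val',
      Matrix.cons_val_fin_one]
    exact hirrr
  have hnull := TypeTwoBlockRoot.natCard_params_iotaShape_null_eq hk2 (!![IsLocalRing.residue (Valued.integer (w.1.adicCompletion L)) (Y 0 0), 0, IsLocalRing.residue (Valued.integer (w.1.adicCompletion L)) (Y 0 1); 0, 0, 0; IsLocalRing.residue (Valued.integer (w.1.adicCompletion L)) (Y 1 0), 0, IsLocalRing.residue (Valued.integer (w.1.adicCompletion L)) (Y 1 1)] : Matrix (Fin 3) (Fin 3) (Valued.ResidueField (w.1.adicCompletion L))) (by simp) (by simp) (by simp) (by simp) (by simp) hdiag' hirr'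
  have hcls := fun (ε : ℤ) (hε : ε = 1 ∨ ε = -1) =>
    TypeTwoBlockRoot.two_mul_natCard_params_iotaShape_quadraticChar_eq hk2 (!![IsLocalRing.residue (Valued.integer (w.1.adicCompletion L)) (Y 0 0), 0, IsLocalRing.residue (Valued.integer (w.1.adicCompletion L)) (Y 0 1); 0, 0, 0; IsLocalRing.residue (Valued.integer (w.1.adicCompletion L)) (Y 1 0), 0, IsLocalRing.residue (Valued.integer (w.1.adicCompletion L)) (Y 1 1)] : Matrix (Fin 3) (Fin 3) (Valued.ResidueField (w.1.adicCompletion L))) (by simp) (by simp) (by simp) (by simp) (by simp) hdiag' hirr' _ hc0 hε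
  have hP1 := hcls 1 (Or.inl rfl)
  have hM1 := hcls (-1) (Or.inr rfl)
  have e00 : (!![IsLocalRing.residue (Valued.integer (w.1.adicCompletion L)) (Y 0 0), 0, IsLocalRing.residue (Valued.integer (w.1.adicCompletion L)) (Y 0 1); 0, 0, 0; IsLocalRing.residue (Valued.integer (w.1.adicCompletion L)) (Y 1 0), 0, IsLocalRing.residue (Valued.integer (w.1.adicCompletion L)) (Y 1 1)] : Matrix (Fin 3) (Fin 3) (Valued.ResidueField (w.1.adicCompletion L))) 0 0 = IsLocalRing.residue (Valued.integer (w.1.adicCompletion L)) (Y 0 0) := rfl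
  have e02 : (!![IsLocalRing.residue (Valued.integer (w.1.adicCompletion L)) (Y 0 0), 0, IsLocalRing.residue (Valued.integer (w.1.adicCompletion L)) (Y 0 1); 0, 0, 0; IsLocalRing.residue (Valued.integer (w.1.adicCompletion L)) (Y 1 0), 0, IsLocalRing.residue (Valued.integer (w.1.adicCompletion L)) (Y 1 1)] : Matrix (Fin 3) (Fin 3) (Valued.ResidueField (w.1.adicCompletion L))) 0 2 = IsLocalRing.residue (Valued.integer (w.1.adicCompletion L)) (Y 0 1) := rfl
  have e20 : (!![IsLocalRing.residue (Valued.integer (w.1.adicCompletion L)) (Y 0 0), 0, IsLocalRing.residue (Valued.integer (w.1.adicCompletion L)) (Y 0 1); 0, 0, 0; IsLocalRing.residue (Valued.integer (w.1.adicCompletion L)) (Y 1 0), 0, IsLocalRing.residue (Valued.integer (w.1.adicCompletion L)) (Y 1 1)] : Matrix (Fin 3) (Fin 3) (Valued.ResidueField (w.1.adicCompletion L))) 2 0 = IsLocalRing.residue (Valued.integer (w.1.adicCompletion L)) (Y 1 0) := rfl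
  rw [e00, e02, e20] at hnull hP1 hM1
  rw [one_mul] at hP1
  rw [neg_one_mul, neg_mul, ← sub_eq_add_neg] at hM1
  have hq : (Fintype.card (Valued.ResidueField (w.1.adicCompletion L)) : ℤ) = (Nat.card (Valued.ResidueField (w.1.adicCompletion L)) : ℤ) := by rw [Nat.card_eq_fintype_card]
  rw [hq] at hP1 hM1
  -- the determinant in `Ȳ₀₀²`-form and the sign dichotomy
  have hD : IsLocalRing.residue (Valued.integer (w.1.adicCompletion L)) (Y 0 0 * Y 1 1 - Y 0 1 * Y 1 0) = (IsLocalRing.residue (Valued.integer (w.1.adicCompletion L)) (Y 0 0) ^ 2 - IsLocalRing.residue (Valued.integer (w.1.adicCompletion L)) (Y 0 1) * IsLocalRing.residue (Valued.integer (w.1.adicCompletion L)) (Y 1 0)) := by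
    rw [map_sub, map_mul, map_mul, ← hdiagr, sq]
  rw [hD] at hHS
  have hD0 : (IsLocalRing.residue (Valued.integer (w.1.adicCompletion L)) (Y 0 0) ^ 2 - IsLocalRing.residue (Valued.integer (w.1.adicCompletion L)) (Y 0 1) * IsLocalRing.residue (Valued.integer (w.1.adicCompletion L)) (Y 1 0)) ≠ 0 := by
    intro h0
    have hsqr : IsSquare (IsLocalRing.residue (Valued.integer (w.1.adicCompletion L)) (Y 0 1) * IsLocalRing.residue (Valued.integer (w.1.adicCompletion L)) (Y 1 0)) :=
      ⟨IsLocalRing.residue (Valued.integer (w.1.adicCompletion L)) (Y 0 0), by rw [← sq]; exact (sub_eq_zero.1 h0).symm⟩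
    exact (quadraticChar_neg_one_iff_not_isSquare.1 hirrr) hsqr
  obtain ⟨-, -, hA⟩ := typeTwo_depthDictionary_odd_ram L w hw he h2 ϖ hϖ hσϖ hblk hu2 hirr hdisc m hm β hβ
  obtain ⟨hHSdich, -⟩ := hA hmN
  have hHS' : hilbertSymbol (v.adicCompletion ↥(maximalRealSubfield L)) (β : v.adicCompletion ↥(maximalRealSubfield L)) (algebraMap ↥(maximalRealSubfield L) _ ((cmQuadraticGenerator L : 𝓞 ↥(maximalRealSubfield L)) : ↥(maximalRealSubfield L))) = -1 ↔ quadraticChar (Valued.ResidueField (w.1.adicCompletion L)) (IsLocalRing.residue (Valued.integer (w.1.adicCompletion L)) (Y 0 0) ^ 2 - IsLocalRing.residue (Valued.integer (w.1.adicCompletion L)) (Y 0 1) * IsLocalRing.residue (Valued.integer (w.1.adicCompletion L)) (Y 1 0)) = -1 := by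
    rw [quadraticChar_eq_neg_one_iff_not_one hD0, ← hHS]
    constructor
    · intro h h1; rw [h1] at h; norm_num at h
    · intro h; exact hHSdich.resolve_left h
  refine ⟨Y, hY, hHS, hHS', hsR, ?_, ?_, ?_⟩
  · rw [hE, Nat.cast_mul]
    exact congrArg (fun t : ℤ => ((Nat.card (Valued.ResidueField (w.1.adicCompletion L)) : ℕ) : ℤ) * t) hnull
  · rw [hP, Nat.cast_mul, mul_left_comm]
    exact congrArg (fun t : ℤ => ((Nat.card (Valued.ResidueField (w.1.adicCompletion L)) : ℕ) : ℤ) * t) hP1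
  · rw [hM, Nat.cast_mul, mul_left_comm]
    exact congrArg (fun t : ℤ => ((Nat.card (Valued.ResidueField (w.1.adicCompletion L)) : ℕ) : ℤ) * t) hM1

end Literature.NumberTheory.Rogawski1990.BlockLawHyp

end
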